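import Summits.BirchSwinnertonDyer.BirchSwinnertonDyer.Theorems.ErratumRoadFiveEulerHalfNotRamPortTargetsOfProducers
import HarnessLib

/-!
# Route `ErratumRoadFive` (K2, `p ≥ 5`), crux `EulerHalfNotRamNoInertSetAtFive` (item stmt-BirchSwinnertonDyer-19715), line `birth` v13:
# THE (DIV) CLAUSE AND THE SAVED ORDER BOUND AT ANY ODD INERT `p ∈ S`, IMAGE-KEYED, GENERIC IN THE TWO SINGLE-DATUM PRODUCERS
# (identity-component input abstracted) — cell `bsd-stepL`, width seat `bsd-line-er5-p1-w3` g5; `--supports stmt-BirchSwinnertonDyer-19715 --as helper`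

WHY THIS FILE. Second stage of the re-threading asked by bsd-idea-9 g7 (HOME INBOX 2026-08-28T13:03:53Z): over the producer-generic port
targets of `…EulerHalfNotRamPortTargetsOfProducers` (`ShimuraWalk.swapSupplyAt_of_poitouTate_of_hceb_of_hSel`,
`Koly.shimuraLevelSupplyAt_of_poitouTate_ofImage_of_producers`), lane B g10's image-keyed swap, (DIV) clause and SAVED ORDER BOUND
(`…ShimuraPortTargetsOfImageTD` §2–§3, `…ShimuraSavedOrderBoundOfImageTD`, p621386) VERBATIM with the per-carrier (B6) labels `hB6T` replaced by
the two producers `hSel` (Gross 6.2 (1) Kummer membership off `n`) and `hstrqT` (Jetchev 4.9 stringent membership at the bad places over each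
carrier `q' ∉ S` with `p ∣ c_{q'}`) as HYPOTHESES:
* §1 `Koly.shimuraSwapSupplyAt_of_poitouTate_ofImage_of_hSel` — PORT TARGET 1, image-keyed (corner-p1's `hceb_family_ofImage`).
* §1 `Koly.shimuraDivClause_of_poitouTate_ofImage_of_producers` — the (DIV) clause from the two targets (`JET.Section6.depth_le_mdiv_of_swap_of_perLevel`).
* §2 `ShimuraKolyvaginOfImage.savedOrderBound_of_labels_ofImage_of_producers` — `ord_p #Ш(E/K)[p^∞] + 2·ord_p c_{q₁}(E) ≤ 2·ord_p [E(K):ℤy]`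
  at any odd inert `p ∈ S`, `q₁ ∉ S`, from `LabelsAt`, the two producers, the four mod-`p` image inputs, Poitou–Tate and `casselsTate_levelInputs K`.
The E′-label instantiation (SAV ∀-form from LAB′) follows in `…EulerHalfNotRamInertSavedOfCarrierE0Prime`.

HONEST FRAMING: conditional theorems (inputs `hPT`, `hCT`, `LabelsAt`, the producers, the image inputs); no definition, no named fact, no `sorry`;
nothing booked; no stub ∕ item closes; 19715 stays OPEN; no census label moves (T7); BSD is proved for no curve.
-- adapted from Summits/…/Theorems/ClassRecordThreeCornerAtThreeShimuraPortTargetsOfImageTD.lean §2–§3 and …ShimuraSavedOrderBoundOfImageTD.lean: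
-- hypotheses `hB6T` ↦ (`hSel`, `hstrqT`), calls re-pointed to the producer-generic port targets, nothing else.
References (locators only): [cite: Jetchev2008, Thm. 1.1, Thm. 1.4 (p. 812), Cor. 1.5, Lemma 5.1] [cite: McCallumLMS1991, §1 Theorem, §5 Prop. 5.2, Cor. 5.6]
[cite: GrossLMS1991, §3 (3.2), §6 Prop. 6.2 (1)] [cite: MilneADT2006, Ch. I Prop. 3.8, Thm. 4.10(b)]. presearch: n/a (re-keying of tree theorems).
Axioms: `propext`, `Classical.choice`, `Quot.sound`.
-/

set_option autoImplicit false
set_option linter.dupNamespace false -- `Summit.BirchSwinnertonDyer.BirchSwinnertonDyer` (summit = problem), tree-wide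

noncomputable section

open scoped Classical NumberField Pointwise

/-! ### §1 The image-keyed swap and the (DIV) clause, generic in the producers -/

namespace Summit.BirchSwinnertonDyer.Rank1Residual.X11b.Three.Koly

open WeierstrassCurve IsDedekindDomain NumberField Field Function Literature.NumberTheory.EllipticCurves
  Literature.NumberTheory.EllipticCurves.ModularForms Literature.NumberTheory.EllipticCurves.Jetchev2008
  Literature.NumberTheory.EllipticCurves.KolyvaginCocycle
  Literature.NumberTheory.EllipticCurves.Rank1Residual Literature.NumberTheory.GaloisRepresentations
  Literature.NumberTheory.GaloisCohomology Literature.NumberTheory.Automorphic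
  Literature.NumberTheory.EllipticCurves.KolyvaginEuler
  Summit.BirchSwinnertonDyer.Rank1Residual.JET Summit.BirchSwinnertonDyer.Rank1Residual.JET.SelmerVocabulary
  Summit.BirchSwinnertonDyer.Rank1Residual.JET.Walk Summit.BirchSwinnertonDyer.Rank1Residual.JET.GlobalDuality
  Summit.BirchSwinnertonDyer.BirchSwinnertonDyer.Theorems
  Literature.NumberTheory.EllipticCurves.ShimuraCMFamily
open Summit.BirchSwinnertonDyer.BirchSwinnertonDyer.Theorems.ShimuraWalk (frobLevelIndex natCast_le_frobLevelIndex_iff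
  LevelSupplyAt LabelsAt)

/-- **PORT TARGET 1 at any odd `p ∈ S`, image-keyed, GENERIC IN THE KUMMER PRODUCER** — `ShimuraWalk.SwapSupplyAt hK ι W N p ys` from `hPT`,
`LabelsAt`, a GIVEN `hSel` and the four mod-`p` image inputs: §1 of `…PortTargetsOfProducers` with corner-p1's `hceb_family_ofImage`.
CONDITIONAL; nothing booked. [cite: McCallumLMS1991, §5 Prop. 5.2, §3 Cor. 3.2] [cite: Jetchev2008, Lemma 5.1] -/
theorem shimuraSwapSupplyAt_of_poitouTate_ofImage_of_hSel
    (hPT : ∀ (K : Type) [Field K] [NumberField K], poitouTate_selmerStructure_duality_conj K)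
    (W : WeierstrassCurve ℚ) [W.IsElliptic] [W.IsGloballyMinimal] (N : ℕ) [NeZero N]
    (K : Type) [Field K] [NumberField K] (S : Finset ℕ) (Dt : ModularParametrizationData W N)
    (hN : W.conductorNorm ℤ = N) {p : ℕ} [Fact p.Prime] (hp2 : p ≠ 2) (hirr : W.HasIrreducibleModPGaloisRep p)
    (hK : IsImaginaryQuadratic K) (hD : NumberField.discr K < -4)
    (hin : ∀ ℓ ∈ S, ℓ.Prime ∧ ℓ ∣ N ∧ ¬ ℓ ^ 2 ∣ N ∧
      ((Ideal.span {(ℓ : ℤ)}).primesOver (𝓞 K)).ncard = 1 ∧ ¬ (ℓ : ℤ) ∣ NumberField.discr K)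
    (hpS : p ∈ S) (ι : K →+* ℂ) (y : (W.baseChange K).toAffine.Point)
    (ys : (m : ℕ) → (W.baseChange (ringClassField K ι m)).toAffine.Point) (ε : ℤ)
    (hL : LabelsAt W N K ι y ys ε)
    (hSel : ∀ (M n : ℕ) (d : KolyvaginFamilyData W K ι n), 1 ≤ M → d.y = ys n → Squarefree n →
      (∀ q' ∈ n.primeFactors, IsKolyvaginPrime N W K p q' ∧ FrobEqFrobInfty W K (p ^ M) q') →
      ∀ 𝔳 : HeightOneSpectrum (𝓞 K), (n : 𝓞 K) ∉ 𝔳.asIdeal →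
        d.kolyvaginClass (Fact.out : p.Prime) M ∈
          selmerLocalKer (W.baseChange K) (𝔳.adicCompletion K) ((p ^ M : ℕ) : ℤ))
    -- the four mod-`p` IMAGE INPUTS over `K` (corner-p1's `_ofImage` binders)
    (hIz : ∃ z : Field.absoluteGaloisGroup K, ∀ t : geomTorsion (W.baseChange K) p, z • t = -t)
    (hIs : (W.baseChange K).HasIrreducibleModPGaloisRep p)
    (hIc : ∀ f : geomTorsion (W.baseChange K) p →+ geomTorsion (W.baseChange K) p,
      (∀ (g : Field.absoluteGaloisGroup K) (t : geomTorsion (W.baseChange K) p), f (g • t) = g • f t) →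
        ∃ k : ℤ, ∀ t, f t = k • t)
    (hIt : AddSubgroup.torsionBy (W.baseChange K).toAffine.Point (p : ℤ) = ⊥)
    : ShimuraWalk.SwapSupplyAt hK ι W N p ys := by
  subst hN
  exact ShimuraWalk.swapSupplyAt_of_poitouTate_of_hceb_of_hSel hPT W (W.conductorNorm ℤ) K S Dt rfl hp2 hirr hK hD hin hpS
    ι y ys ε hL hSel (hceb_family_ofImage W hK hp2 hIz hIs hIc hIt)

set_option maxHeartbeats 400000 in
/-- **The (DIV) CLAUSE at any odd `p ∈ S`, image-keyed, GENERIC IN THE TWO PRODUCERS** — Jetchev's global divisibility of the derived points in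
McCallum's presentation-free currency (`∀ q ∉ S, s ≤ ord_p c_q ⟹ p^{M−s}·P_{k'} ∈ p^M·E(K[k'])` on Gross–Kolyvagin levels with `Frob = Frob_∞`),
from the two producer-generic port targets by the (DIV) glue `JET.Section6.depth_le_mdiv_of_swap_of_perLevel`; lane B g10's
`shimuraDivClause_of_poitouTate_ofImage_of_carrierLabels` VERBATIM with `hB6T` ↦ (`hSel`, `hstrqT`). CONDITIONAL; nothing booked.
[cite: Jetchev2008, Thm. 1.1, Thm. 1.4 (p. 812)] [cite: McCallumLMS1991, §5 Prop. 5.2, Cor. 5.6] -/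
theorem shimuraDivClause_of_poitouTate_ofImage_of_producers
    (hPT : ∀ (K : Type) [Field K] [NumberField K], poitouTate_selmerStructure_duality_conj K)
    (W : WeierstrassCurve ℚ) [W.IsElliptic] [W.IsGloballyMinimal] (N : ℕ) [NeZero N]
    (K : Type) [Field K] [NumberField K] (S : Finset ℕ) (Dt : ModularParametrizationData W N)
    (hN : W.conductorNorm ℤ = N) {p : ℕ} [Fact p.Prime] (hp2 : p ≠ 2) (hirr : W.HasIrreducibleModPGaloisRep p)
    (hK : IsImaginaryQuadratic K) (hD : NumberField.discr K < -4)
    (hin : ∀ ℓ ∈ S, ℓ.Prime ∧ ℓ ∣ N ∧ ¬ ℓ ^ 2 ∣ N ∧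
      ((Ideal.span {(ℓ : ℤ)}).primesOver (𝓞 K)).ncard = 1 ∧ ¬ (ℓ : ℤ) ∣ NumberField.discr K)
    (hsp : ∀ ℓ : ℕ, ℓ.Prime → ℓ ∣ N → ℓ ∉ S → ((Ideal.span {(ℓ : ℤ)}).primesOver (𝓞 K)).ncard = 2)
    (hpS : p ∈ S) (ι : K →+* ℂ) (y : (W.baseChange K).toAffine.Point)
    (ys : (m : ℕ) → (W.baseChange (ringClassField K ι m)).toAffine.Point) (ε : ℤ)
    (hL : LabelsAt W N K ι y ys ε)
    (hSel : ∀ (M n : ℕ) (d : KolyvaginFamilyData W K ι n), 1 ≤ M → d.y = ys n → Squarefree n →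
      (∀ q' ∈ n.primeFactors, IsKolyvaginPrime N W K p q' ∧ FrobEqFrobInfty W K (p ^ M) q') →
      ∀ 𝔳 : HeightOneSpectrum (𝓞 K), (n : 𝓞 K) ∉ 𝔳.asIdeal →
        d.kolyvaginClass (Fact.out : p.Prime) M ∈
          selmerLocalKer (W.baseChange K) (𝔳.adicCompletion K) ((p ^ M : ℕ) : ℤ))
    (hstrqT : ∀ (q' : ℕ) [Fact q'.Prime], q' ∣ N → q' ∉ S → p ∣ (W.baseChange ℚ_[q']).localTamagawaNumber ℤ_[q'] →
      ∀ (k : ℕ) (hn : ((p ^ k : ℕ) : ℤ) ≠ 0) (n : ℕ) (d : KolyvaginFamilyData W K ι n), 1 ≤ k → d.y = ys n →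
      Squarefree n →
      (∀ q'' ∈ n.primeFactors, IsKolyvaginPrime N W K p q'' ∧ FrobEqFrobInfty W K (p ^ k) q'') →
      ∀ v : HeightOneSpectrum (𝓞 K), ((q' : ℕ) : 𝓞 K) ∈ v.asIdeal → ¬ (W.baseChange K).HasGoodReductionAt v →
        galoisCohomology.localization ((W.baseChange K).torsionGaloisModule ((p ^ k : ℕ) : ℤ)) (Sum.inr v) 1
          (d.kolyvaginClass (Fact.out : p.Prime) k) ∈ stringentFamily W K hn (Sum.inr v))
    -- the four mod-`p` IMAGE INPUTS over `K` (corner-p1's `_ofImage` binders)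
    (hIz : ∃ z : Field.absoluteGaloisGroup K, ∀ t : geomTorsion (W.baseChange K) p, z • t = -t)
    (hIs : (W.baseChange K).HasIrreducibleModPGaloisRep p)
    (hIc : ∀ f : geomTorsion (W.baseChange K) p →+ geomTorsion (W.baseChange K) p,
      (∀ (g : Field.absoluteGaloisGroup K) (t : geomTorsion (W.baseChange K) p), f (g • t) = g • f t) →
        ∃ k : ℤ, ∀ t, f t = k • t)
    (hIt : AddSubgroup.torsionBy (W.baseChange K).toAffine.Point (p : ℤ) = ⊥)
    :
    ∀ (q : ℕ) [Fact q.Prime] (s : ℕ), q ∉ S →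
          s ≤ padicValNat p ((W.baseChange ℚ_[q]).localTamagawaNumber ℤ_[q]) →
        ∀ (k M k' : ℕ), Squarefree k' →
          (∀ q' ∈ k'.primeFactors, Literature.NumberTheory.EllipticCurves.IsKolyvaginPrime N W K p q' ∧
            Literature.NumberTheory.EllipticCurves.FrobEqFrobInfty W K (p ^ (M + k)) q') →
          letI : CommGroup (Literature.NumberTheory.EllipticCurves.ringClassGal ι k') :=
            { (inferInstance : Group (Literature.NumberTheory.EllipticCurves.ringClassGal ι k')) with
              mul_comm := fun a b ↦
                (KolyvaginH44.isMulCommutative_ringClassGal' hK ι k').is_comm.comm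
                  a b }
          letI : DistribMulAction (Literature.NumberTheory.EllipticCurves.ringClassGal ι k')
              ((W.baseChange (Literature.NumberTheory.EllipticCurves.ringClassField K ι k')).toAffine.Point) :=
            DistribMulAction.compHom _
              ((Literature.NumberTheory.EllipticCurves.pointGalHom W
                (Literature.NumberTheory.EllipticCurves.ringClassField K ι k')).comp
                (Literature.NumberTheory.EllipticCurves.ringClassGal ι k').subtype)
          ∀ (σ' : ℕ → Literature.NumberTheory.EllipticCurves.ringClassGal ι k')
            (H' : Subgroup (Literature.NumberTheory.EllipticCurves.ringClassGal ι k'))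
            [Fintype (Literature.NumberTheory.EllipticCurves.ringClassGal ι k' ⧸ H')]
            (f' : Literature.NumberTheory.EllipticCurves.ringClassGal ι k' ⧸ H' →
              Literature.NumberTheory.EllipticCurves.ringClassGal ι k'),
            (∀ q' ∈ k'.primeFactors, σ' q' ^ (q' + 1) = 1) →
            (∀ q' ∈ k'.primeFactors,
              Subgroup.zpowers (σ' q' : Literature.NumberTheory.EllipticCurves.ringClassField K ι k' ≃ₐ[ℚ]
                Literature.NumberTheory.EllipticCurves.ringClassField K ι k') =
                Literature.NumberTheory.EllipticCurves.ringClassGalOver ι k' (k' / q')) →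
            (∀ c, (f' c : Literature.NumberTheory.EllipticCurves.ringClassGal ι k' ⧸ H') = c) →
            (∀ h ∈ H', (h : Literature.NumberTheory.EllipticCurves.ringClassField K ι k' ≃ₐ[ℚ]
              Literature.NumberTheory.EllipticCurves.ringClassField K ι k') ∈
                Literature.NumberTheory.EllipticCurves.ringClassGalOver ι k' 1) →
            ∃ B : (W.baseChange (Literature.NumberTheory.EllipticCurves.ringClassField K ι k')).toAffine.Point,
              ((p ^ M : ℕ) : ℤ) • B =
                ((p : ℤ) ^ (M - s)) • kolyvaginPoint σ'
                  k'.primeFactors f' (ys k')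
 := by
  intro q _ s hqS hs k M k' hk' hKol σ' H' instF f' h1 h2 h3 h4
  have hswap : ShimuraWalk.SwapSupplyAt hK ι W N p ys :=
    shimuraSwapSupplyAt_of_poitouTate_ofImage_of_hSel hPT W N K S Dt hN hp2 hirr hK hD hin hpS ι y ys ε hL hSel hIz hIs hIc hIt
  have hlev := shimuraLevelSupplyAt_of_poitouTate_ofImage_of_producers hPT W N K S Dt hN hp2 hirr hK hD hin hsp hpS ι y ys ε hL hSel
    hstrqT hIz hIs hIc hIt q hqS
  set t : ℕ := padicValNat p ((W.baseChange ℚ_[q]).localTamagawaNumber ℤ_[q]) with ht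
  have hKol' : ∀ q' ∈ k'.primeFactors, IsKolyvaginPrime N W K p q' := fun q' hq' ↦ (hKol q' hq').1
  let c : ShimuraWalk.Conductor W K N p := ⟨k', hk', hKol'⟩
  have key : ∀ s' : ℕ, s' ≤ t → s' ≤ M + k → ShimuraWalk.PDiv hK ι W ys p k' s' := by
    intro s' hs't hs'Mk
    have hidx : (s' : ℕ∞) ≤ frobLevelIndex W K p k' :=
      (natCast_le_frobLevelIndex_iff hKol' s').mpr fun q' hq' ↦ (hKol q' hq').2.of_dvd (pow_dvd_pow p hs'Mk)
    have h := JET.Section6.depth_le_mdiv_of_swap_of_perLevel (Λ := ShimuraWalk.Conductor W K N p)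
      (fun c ↦ frobLevelIndex W K p c.1) (fun c ↦ ShimuraWalk.mdiv hK ι W ys p c.1) t hswap hlev s' hs't c hidx
    exact (ShimuraWalk.natCast_le_mdiv_iff hK ι W ys p k' s').mp h
  by_cases hsM : s ≤ M
  · obtain ⟨B₀, hB₀⟩ := key s hs (hsM.trans (Nat.le_add_right M k)) σ' H' f' h1 h2 h3 h4
    refine ⟨B₀, Eq.trans ?_ (congrArg (fun x ↦ ((p : ℤ) ^ (M - s)) • x) hB₀)⟩
    show ((p ^ M : ℕ) : ℤ) • B₀ = ((p : ℤ) ^ (M - s)) • (((p ^ s : ℕ) : ℤ) • B₀)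
    rw [smul_smul]
    congr 1
    push_cast
    rw [← pow_add, Nat.sub_add_cancel hsM]
  · push Not at hsM
    obtain ⟨B₀, hB₀⟩ := key M (hsM.le.trans hs) (Nat.le_add_right M k) σ' H' f' h1 h2 h3 h4
    refine ⟨B₀, hB₀.trans ?_⟩
    rw [Nat.sub_eq_zero_of_le hsM.le, pow_zero, one_smul]

end Summit.BirchSwinnertonDyer.Rank1Residual.X11b.Three.Koly

/-! ### §2 The saved order bound, generic in the producers -/

namespace Summit.BirchSwinnertonDyer.BirchSwinnertonDyer.Theorems.ShimuraKolyvaginOfImage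

open WeierstrassCurve NumberField IsDedekindDomain Field Function Finset Literature.NumberTheory.EllipticCurves
  Literature.NumberTheory.GaloisRepresentations Literature.NumberTheory.GaloisCohomology
  Literature.NumberTheory.EllipticCurves.KolyvaginCocycle Literature.NumberTheory.EllipticCurves.RingClassField
  Literature.NumberTheory.EllipticCurves.ModularForms Literature.NumberTheory.EllipticCurves.Rank1Residual
  Literature.NumberTheory.EllipticCurves.KolyvaginEuler Literature.NumberTheory.EllipticCurves.KolyvaginDescent
  Summit.BirchSwinnertonDyer.Rank1Residual Summit.BirchSwinnertonDyer.Rank1Residual.X11b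
  Summit.BirchSwinnertonDyer.Rank1Residual.JET
  Literature.NumberTheory.EllipticCurves.ShimuraCMFamily

/-- **The SAVED order bound `ord_p #Ш(E/K)[p^∞] + 2·ord_p c_{q₁}(E) ≤ 2·ord_p [E(K):ℤy]` at any odd inert `p ∈ S`, `q₁ ∉ S`, GENERIC IN THE TWO
PRODUCERS** (`hSel`, `hstrqT` as hypotheses), from `LabelsAt`, the four mod-`p` image inputs, Poitou–Tate and `casselsTate_levelInputs K` — p621386
(`savedOrderBound_of_labels_ofImage_of_carrierLabels`) VERBATIM with `hB6T` ↦ the producers; the `hDivLab` of the `p`-generic order END is §1's (DIV)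
clause. CONDITIONAL; nothing booked. [cite: Jetchev2008, Thm. 1.1 and Cor. 1.5] [cite: McCallumLMS1991, §1 Theorem (Kolyvagin), Cor. 5.6]
[cite: MilneADT2006, Ch. I Prop. 3.8] -/
theorem savedOrderBound_of_labels_ofImage_of_producers
    (hPT : ∀ (K : Type) [Field K] [NumberField K], poitouTate_selmerStructure_duality_conj K)
    (W : WeierstrassCurve ℚ) [W.IsElliptic] [W.IsGloballyMinimal] (N : ℕ) [NeZero N]
    (K : Type) [Field K] [NumberField K] (S : Finset ℕ) (Dt : ModularParametrizationData W N)
    (hN : W.conductorNorm ℤ = N) {p : ℕ} [Fact p.Prime] (hp2 : p ≠ 2) (hirr : W.HasIrreducibleModPGaloisRep p)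
    (hK : IsImaginaryQuadratic K) (hD : NumberField.discr K < -4)
    (hin : ∀ ℓ ∈ S, ℓ.Prime ∧ ℓ ∣ N ∧ ¬ ℓ ^ 2 ∣ N ∧
      ((Ideal.span {(ℓ : ℤ)}).primesOver (𝓞 K)).ncard = 1 ∧ ¬ (ℓ : ℤ) ∣ NumberField.discr K)
    (hsp : ∀ ℓ : ℕ, ℓ.Prime → ℓ ∣ N → ℓ ∉ S → ((Ideal.span {(ℓ : ℤ)}).primesOver (𝓞 K)).ncard = 2)
    (hpS : p ∈ S) (ι : K →+* ℂ) (y : (W.baseChange K).toAffine.Point)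
    (ys : (m : ℕ) → (W.baseChange (ringClassField K ι m)).toAffine.Point) (ε : ℤ)
    (hL : ShimuraWalk.LabelsAt W N K ι y ys ε)
    (hSel : ∀ (M n : ℕ) (d : KolyvaginFamilyData W K ι n), 1 ≤ M → d.y = ys n → Squarefree n →
      (∀ q' ∈ n.primeFactors, IsKolyvaginPrime N W K p q' ∧ FrobEqFrobInfty W K (p ^ M) q') →
      ∀ 𝔳 : HeightOneSpectrum (𝓞 K), (n : 𝓞 K) ∉ 𝔳.asIdeal →
        d.kolyvaginClass (Fact.out : p.Prime) M ∈
          selmerLocalKer (W.baseChange K) (𝔳.adicCompletion K) ((p ^ M : ℕ) : ℤ))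
    (hstrqT : ∀ (q' : ℕ) [Fact q'.Prime], q' ∣ N → q' ∉ S → p ∣ (W.baseChange ℚ_[q']).localTamagawaNumber ℤ_[q'] →
      ∀ (k : ℕ) (hn : ((p ^ k : ℕ) : ℤ) ≠ 0) (n : ℕ) (d : KolyvaginFamilyData W K ι n), 1 ≤ k → d.y = ys n →
      Squarefree n →
      (∀ q'' ∈ n.primeFactors, IsKolyvaginPrime N W K p q'' ∧ FrobEqFrobInfty W K (p ^ k) q'') →
      ∀ v : HeightOneSpectrum (𝓞 K), ((q' : ℕ) : 𝓞 K) ∈ v.asIdeal → ¬ (W.baseChange K).HasGoodReductionAt v →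
        galoisCohomology.localization ((W.baseChange K).torsionGaloisModule ((p ^ k : ℕ) : ℤ)) (Sum.inr v) 1
          (d.kolyvaginClass (Fact.out : p.Prime) k) ∈ stringentFamily W K hn (Sum.inr v))
    (hIz : ∃ z : Field.absoluteGaloisGroup K, ∀ t : geomTorsion (W.baseChange K) p, z • t = -t)
    (hIs : (W.baseChange K).HasIrreducibleModPGaloisRep p)
    (hIc : ∀ f : geomTorsion (W.baseChange K) p →+ geomTorsion (W.baseChange K) p,
      (∀ (g : Field.absoluteGaloisGroup K) (t : geomTorsion (W.baseChange K) p), f (g • t) = g • f t) →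
        ∃ k : ℤ, ∀ t, f t = k • t)
    (hIt : AddSubgroup.torsionBy (W.baseChange K).toAffine.Point (p : ℤ) = ⊥)
    (hCT : Literature.NumberTheory.EllipticCurves.casselsTate_levelInputs K)
    (hguard : ¬ IsOfFinAddOrder y → 0 < (AddSubgroup.zmultiples y).index) (hnt : ¬ IsOfFinAddOrder y)
    (q₁ : ℕ) [Fact q₁.Prime] (hq₁S : q₁ ∉ S) :
    padicValNat p (Nat.card (AddCommGroup.primaryComponent (W.baseChange K).sha p)) +
        2 * padicValNat p ((W.baseChange ℚ_[q₁]).localTamagawaNumber ℤ_[q₁]) ≤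
      2 * padicValNat p (AddSubgroup.zmultiples y).index := by
  obtain ⟨hε, hB2, hB3, hB3K, hB4, hB5⟩ := id hL
  have hDIV := Summit.BirchSwinnertonDyer.Rank1Residual.X11b.Three.Koly.shimuraDivClause_of_poitouTate_ofImage_of_producers hPT W N K S
    Dt hN hp2 hirr hK hD hin hsp hpS ι y ys ε hL hSel hstrqT hIz hIs hIc hIt
  exact padicValNat_card_sha_primary_add_le_of_shimuraLabels_ofImage_of_casselsTate_of_divLab hCT hN hp2 hirr hK ι Dt hin hsp hpS
    hIz hIs hIc hIt ys hε hguard hB2 hB3 hB3K hB4 hB5 _ (hDIV q₁ _ hq₁S le_rfl) hnt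

end Summit.BirchSwinnertonDyer.BirchSwinnertonDyer.Theorems.ShimuraKolyvaginOfImage

end
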